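import Literature.MathematicalPhysics.QuantumFieldTheory.Balaban1983to89.T3UnitLawDensityEML
import Literature.MathematicalPhysics.QuantumFieldTheory.Balaban1983to89.B5Eq118OneStroke
import HarnessLib

/-!
# `Balaban1983to89.BalabanUVClass` — BAŁABAN'S CLASS OF EFFECTIVE DENSITIES (small-field effective action of a background
# field + localised, exponentially clustering activities + large-field small factors), typed WITH A BODY over the shared
# `Setup` vocabulary, and its reading at height `j` of the d = 3 Wilson towers of a `T3Family`

Work item `defn-BalabanUVClass` (kind definition; requested by `planner-ym-r3-idea-1-g4-0` for the crux
`Summit.QuantumFields.YangMills.Theses.UVClassRigidity.LimitTrajectoriesUVEquivalent`, stmt-QuantumFields-26905, route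
`UVClassRigidity`, rung R3).  The request: «the faithful Bałaban polymer-expansion class of height-`j` effective densities on
`GaugeField (F.P j) 0 SU(2)` … analytic small-field effective action on `{PlaqSmall δ_j}` with boundary/fluctuation terms localised in
polymers `X` with activities `|E(X)| ≤ O(1) g_j² p₀(g_j)² exp(−κ d(X))` uniformly in the cutoff `K`; large-field structure with
per-plaquette rarity `exp(−c p₀(g_j)²)` … published results only; no conjecture».

## What this file is

**§1 (generic, `Setup` vocabulary; any `Params`, level `k`, gauge group `G`, averaging family `av`).**  A real STRUCTURE WITH A BODY,
`Witness av prm r`, recording — for ONE density `r : GaugeField P k G → ℝ` on the level-`k` lattice `T^{(k)}` of a run whose finest lattice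
is `T^{(0)} = T_η` — the data and the PRINTED STRUCTURAL CLAUSES of Bałaban's effective densities, each clause with its locator:

* the BACKGROUND (minimal) configuration `U_k(V)` on `T_η` determined by the datum `V` ([Balaban1985UV3] (42) p.266 at the trivial
  history «it is a minimum of the functional U ↦ A(U) with the restrictions … V_k = V»; [Balaban1987RG1] (0.21)–(0.22) p.256 «the minima
  of the functional U ↦ A(U) on U: Ū^k = M^k(U) = V … A_k(g_k, V) = −(1/g_k²)A(U_k(V)) + E_k(U_k(V))»; existence/uniqueness of the
  minimal orbit is [Balaban1985Variational] Thm 1 p.279) — typed through `Setup.IsBackground` over a regular window `PlaqSmall δreg`;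
* a finite system of LOCALISATION DOMAINS with their fine supports `X̃ ⊂ T_η` (as bond sets), level-`k` footprints, linear sizes
  `𝓛(X) ≥ 0` ([Balaban1985UV3] (24) p.262 «Localizations X are connected unions of big blocks … a linear size 𝓛(X) of a localization X as
  the length of a shortest tree graph connecting the centers of big blocks in X»; [Balaban1987RG1] p.257 `d_j(X)`), and ACTIVITIES
  `E(X, U)` that are LOCAL (p.263 «depends on U₁ restricted to the set X̃»), GAUGE INVARIANT ((26) p.263) and EXPONENTIALLY SMALL IN
  THE LINEAR SIZE at the background of a small datum ((25) p.262 «|𝒫′₁(g₀, X, U₁)| ≤ O(g₀)e^{−κ𝓛(X)}», (43)–(44) p.266–267;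
  [Balaban1987RG1] (0.25) p.257 «|E^{(j)}(X, U)| ≤ E₀ exp(−κ d_j(X))»), with the LOCAL SUMMABILITY of (45) p.267 («summation over all Y_j
  with y fixed yields …») / (0.26) p.257;
* the TWO-SIDED SMALL-FIELD REPRESENTATION with a `V`-independent slack: on the all-small datum set `{PlaqSmall δ}`,
  `exp(−β·A(U_k(V)) + Σ_X E(X, U_k(V)) + cst − slack) ≤ r(V) ≤ exp(same + slack) + lf(V)` — the trivial-history term of the inductive
  inequalities (47) p.267 (lower) and (41) p.266 (upper, the remaining large-field histories collected in `lf ≥ 0`), `cst = −E_k` with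
  (65) p.273 «|E_k| ≤ O(1)|T₁^{(k)}|», `slack` = the remainder «Σ_{j<k} O((Lʲε)^{3+κ₀})|T₁^{(j)}|»;
* the LARGE-FIELD SMALL FACTORS of Sect. D: every large plaquette yields `exp(−¼p²(g))` ((67)–(71) p.273 «the corresponding part of
  the exponential gives the small factor exp(−¼p²(g_j)). We get these small factors for all plaquettes in all large fields set P …
  these small factors are enough to control all sums in (41) … This gives the upper bound in (5)»; [Balaban1988Convergent] p.244 «For
  d < 4 … the bound above can be estimated by an arbitrarily large power of ε. This is enough to control expressions arising in the
  large field regions surrounding the plaquette p for all steps of the procedure»): `lf ≤ e^{−cLF}·e^{c5|T^{(k)}|}` and, for a datum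
  with `n` large top-level plaquettes, `r ≤ e^{−cLF·n}·e^{c5|T^{(k)}|}` (`n = 0`: the upper bound (5) p.256 of Theorem 1 p.257);
* positivity ([Balaban1989LargeFieldI] p.176 «We will prove that the densities are positive»), gauge invariance ([Balaban1985Averaging]
  (12)–(13) p.19), measurability.

`Mem av prm r := Nonempty (Witness av prm r)` is MEMBERSHIP in the class with parameters `prm : ClassParams` (all O(1)'s explicit reals).
PROVED bookkeeping (no content of the series): the sum of the activities at the background of a small datum is `≤ Ccov·|T^{(k)}|`
((46) p.267 «Thus the sum is not only convergent, but also small» / (0.30) p.258, from the per-footprint summability by double counting: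
`Witness.sum_abs_act_le`); hence THEOREM 1's bounds (5) p.256 FROM THE CLAUSES (`Witness.bounds5_lower` — p.274 «The lower bound is
simpler, it is enough to use (44)–(46) and (66)» — and `Witness.bounds5_upper`), and their `Mem` forms.

**§2 (the d = 3 towers of a `T3Family`, any small-loop average `ℰ`).**  The planner's «height `j`» space `GaugeField (F.P j) 0 G` IS level
`K − j` of run `K` (`K ≥ j`) through the tree's level identification `T3LevelShift.fieldShift` (equal moduli `2L^{m+j}`); `readAtLevel`
performs that reading, `MemOfRun F ℰ hK prm r` := membership of the height-`j` density `r` read on run `K`'s level `K − j` with the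
background on run `K`'s finest lattice `T_{ε_K}` and the averaging `BlockAveraging.blockAvg ℰ` (the averaging of record is
`T3UnitLawDensityEML.ℰp`), and `MemAtHeight F ℰ j prm r := ∃ K ≥ j, MemOfRun …` (the fine run is part of the witness).  «Uniformly in
the cutoff K» is then the consumer's sentence `∀ K ≥ j, MemOfRun F ℰp hK (prm j) (r K)` with ONE `prm j` per height (g_k of run `K` at
level `K − j` is `g·L^{−j/2}` in unit-lattice units, independent of `K`: [Balaban1985UV3] p.256 «g_k = g(Lᵏε)^{1/2}»).

## What this file is NOT (honest framing)

* NOTHING of Bałaban's series is asserted: no `def … : Prop` names a theorem of the papers; `Mem`/`MemOfRun`/`MemAtHeight` are PREDICATES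
  on a given density, inhabited only by whoever constructs a `Witness`.  That the height densities of the `(F, γ)` Wilson runs are members
  with `K`-uniform parameters is [Balaban1985UV3] Thm 2 p.272 + Sect. D (for Bałaban's own averaging; for `ℰp` it is the construction
  statement the cell `ym3-torus` records as located-unprinted, cf. `T3AlphaInputsAC` header) — a ROUTE obligation
  (`stub_uniformUVStructure`), not typed here as a fact (D-0026).  Heightwise LIMITS `K → ∞` are not covered by any printed sentence.
* ANALYTICITY of the activities in the background (p.263 «The third property is the analyticity with respect to U₁»; [Balaban1987RG1]
  p.257 «analytic … functions of U», complex regular spaces §1 p.262) is NOT encoded (no complexification `Gᶜ` in `Setup`; cf. `Setup`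
  DIVERGENCE F4/F8) — the clauses here are its printed CONSEQUENCES (25)/(44) on real fields.  The QUASI-LOCALITY of `V ↦ U_k(V)`
  ([Balaban1985Variational] Sect. F) is not a clause either: `bg` is bare data + `IsBackground`.
* Print gives NO pointwise RELATIVE smallness `lf ≤ η·(trivial term)` on the small-datum set, and (41) is an INEQUALITY in
  [Balaban1985UV3] (an identity `ρ = Σ_Z ρ(Z, ·)` only in the d = 4 sequels [Balaban1988Convergent] (2.18), [Balaban1989LargeFieldI]
  (0.2)); the two-trajectory «shadow» (one-bond oscillation, two-bond clustering of `log r − log r′`) of the route `UVClassRigidity` is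
  therefore NOT a field of this structure — it is what the route's cruxes must extract.
* Multi-scale domains: print's localisations at step `k` live on all scales `i ≤ k` with the size factor `(Lⁱη)⁴` of (44)–(45); here a
  per-domain weight `wt X ≥ 0` carries that factor and the summability clause is stated per level-`k` footprint site, which is the
  summed form (46)/(0.30) — a READING, flagged as such in the docstrings.
* No `instance`, no notation, no named fact; imports `T3UnitLawDensityEML` (for `T3Family`, `fieldShift`, `blockAvg`, `ℰp`) and
  `B5Eq118OneStroke` (the `k`-fold block map `iterBlockOf`), nothing else.

References (pages read on the held texts `paper:balaban1985-cmp102-uv-stability-3d` pp.256–257, 262–263, 265–267, 272–274;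
`paper:balaban1987-cmp109-rg-i-small-field` pp.256–258; `paper:balaban1988-cmp119-convergent-renormalization` pp.244–247;
`paper:balaban1989-cmp122-large-field-i` p.176): T. Bałaban, CMP **102** (1985) 255–275 [Balaban1985UV3]; CMP **102** (1985) 277–309
[Balaban1985Variational]; CMP **98** (1985) 17–51 [Balaban1985Averaging]; CMP **109** (1987) 249–301 [Balaban1987RG1]; CMP **119** (1988)
243–285 [Balaban1988Convergent]; CMP **122** (1989) 175–202 [Balaban1989LargeFieldI]; CMP **86** (1982) 555–594 [Balaban1982Higgs2]
(Sect. 3.C, the model-independent combinatorial estimate invoked on p.273).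
-/

noncomputable section

open MeasureTheory
open Literature.MathematicalPhysics.QuantumFieldTheory
open Literature.MathematicalPhysics.QuantumFieldTheory.Balaban1983to89.T3ContinuumYM3Torus
open Literature.MathematicalPhysics.QuantumFieldTheory.Balaban1983to89.T3LevelShift
open Literature.MathematicalPhysics.QuantumFieldTheory.Balaban1983to89.B5Eq118OneStroke (iterBlockOf)

namespace Literature.MathematicalPhysics.QuantumFieldTheory.Balaban1983to89.BalabanUVClass

/-! ## §1 The class at one level of one run (generic `Setup` vocabulary) -/

/-- **THE CLASS PARAMETERS AT ONE LEVEL** — every «O(1)» of the printed clauses as an explicit real (dependences are the consumer's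
hypotheses, never fixed here):
`δ` = the all-small window of the datum `V` on which the two-sided representation is stated ((47) p.267 «|U_k(∂p) − 1| < g_kp(g_k)η²»,
read on `V`; [Balaban1988Convergent] (1.4) p.246 `ε_k = g_kp₀(g_k)`); `δreg` = the regular window of the fine configurations among which
the background is minimal ([Balaban1985Variational] Thm 1: the space `𝔘_k(B₃ε₁)`); `δL` = the large-plaquette threshold of Sect. D
(p.273 «|V_j(∂p′) − 1| ≥ g_jp(g_j)»); `β` = the coefficient of the Wilson action of the background ((5)/(41): `1/g_k²` times the `η^{−1}`
weight of `A^η`, in d = 3 `= 1/(g²ε)`); `κ` = the decay rate in the linear size ((25)); `M` = the footprint-diameter constant (domains of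
level `i ≤ k` in a cube of side `RM₁` of their scale, p.263); `Ccov` = the per-site activity budget ((45)–(46): `O(1)M₁³g²_{k−1}p²(g_{k−1})`);
`cE` = the per-site vacuum-energy constant ((65)); `slack` = the remainder of (41)/(47); `cLF` = the large-field exponent `¼p²(g_k)` ((71));
`c5` = the constant of (5). [cite: Balaban1985UV3, (5) p.256, (25) p.262, (41) p.266, (45)-(47) p.267, (65) p.273, (71) p.273] -/
structure ClassParams where
  /-- all-small window of the level-`k` datum -/
  δ : ℝ
  /-- regular window of the fine configurations (background class) -/
  δreg : ℝ
  /-- large-plaquette threshold of the level-`k` datum -/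
  δL : ℝ
  /-- coefficient of the fine Wilson action of the background -/
  β : ℝ
  /-- decay rate in the linear size of a localisation domain -/
  κ : ℝ
  /-- footprint-diameter constant -/
  M : ℝ
  /-- per-site activity budget -/
  Ccov : ℝ
  /-- per-site vacuum-energy constant -/
  cE : ℝ
  /-- the `V`-independent remainder of the two-sided representation -/
  slack : ℝ
  /-- large-field exponent per large plaquette -/
  cLF : ℝ
  /-- the constant of the ultraviolet-stability bound (5) -/
  c5 : ℝ

variable {P : Params} {k : ℕ} {G : Type*} [GaugeGroup G] [MeasurableSpace G]

/-- **A WITNESS OF MEMBERSHIP IN BAŁABAN'S CLASS** for a density `r` on the level-`k` lattice `T^{(k)}` of the run `P` (finest lattice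
`T^{(0)} = T_η`), with respect to the averaging family `av` and the parameters `prm` — the DATA of the printed representation (background,
localisation domains with fine supports / level-`k` footprints / linear sizes / weights, activities, the constant `−E_k`, the large-field
part) together with its PRINTED CLAUSES, each cited at its field.  Inline, `eff(V) := −β·A(bg V) + Σ_X act X (bg V) + cst` is the
small-field effective action (41)/(47) p.266–267 = [Balaban1987RG1] (0.22) p.256 «A_k(g_k, V) = −(1/g_k²)A(U_k(V)) + E_k(U_k(V))»
(see `Witness.eff`).  Analyticity (p.263) and the quasi-locality of `V ↦ U_k(V)` are NOT encoded (module header).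
[cite: Balaban1985UV3, (41)-(47) pp.266-267; Balaban1987RG1, (0.21)-(0.25) pp.256-257] -/
structure Witness (av : (i : ℕ) → Averaging P i G) (prm : ClassParams) (r : GaugeField P k G → ℝ) where
  /-- The background `U_k(V) ∈ T_η` of a datum `V ∈ T^{(k)}` ((42) p.266 at the trivial history; [Balaban1987RG1] (0.21) p.256). -/
  bg : GaugeField P k G → GaugeField P 0 G
  /-- The number of localisation domains (a finite family; (24) p.262, (43) p.266: all levels `i ≤ k` together). -/
  nDom : ℕ
  /-- The fine bonds the activity of the domain depends on — print's `X̃ = ∪_{□⊂X} □̃` read as a bond set (p.263). -/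
  supp : Fin nDom → Set (PBond P 0)
  /-- The footprint of the domain on `T^{(k)}`: the level-`k` sites above its fine support (the blocks `y` of (43) p.266 read at level `k`). -/
  foot : Fin nDom → Finset (Site P k)
  /-- The linear size `𝓛(X) ≥ 0` ((24)–(25) p.262; [Balaban1987RG1] p.257 `d_j(X)`). -/
  len : Fin nDom → ℝ
  /-- The size weight of the domain (the factor `(Lⁱη)⁴·(g_{k−1}p(g_{k−1}))²·O(1)` of (44)–(45) p.267 for a level-`i` domain; `E₀` of (0.25)). -/
  wt : Fin nDom → ℝ
  /-- The activity `E(X, U) = 𝒫_i(Y_i, U)` as a function of the FINE configuration ((24) p.262, (43) p.266; (0.24) p.257). -/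
  act : Fin nDom → GaugeField P 0 G → ℝ
  /-- The constant `−E_k` of (41)/(47) ((36) p.265 «E₁ = E − E^{(0)}», (64) p.273). -/
  cst : ℝ
  /-- The large-field part: the histories of (41) p.266 other than the trivial one ([Balaban1989LargeFieldI] (0.2) p.176 «ρ(V) = Σ_Z ρ(Z, V)
  where the sum is over large field regions Z», the `Z ≠ ∅` terms). -/
  lf : GaugeField P k G → ℝ
  /-- POSITIVITY of the density ([Balaban1989LargeFieldI] p.176 «We will prove that the densities are positive»; `ρ_k = T^kρ₀`, `ρ₀ > 0`). -/
  nonneg : ∀ V, 0 ≤ r V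
  /-- MEASURABILITY of the density (it is integrated against the product Haar measure `dV`, [Balaban1985Averaging] (10) p.19). -/
  measurable : Measurable r
  /-- GAUGE INVARIANCE of the density ([Balaban1985Averaging] (12)–(13) p.19: `T` maps gauge-invariant densities to gauge-invariant ones). -/
  gaugeInvariant : GaugeField.GaugeInvariant r
  /-- THE BACKGROUND IS THE REGULAR MINIMISER OVER THE DATUM ((42) p.266 «a minimum of the functional U ↦ A(U) with the restrictions
  U: Ū_j = V_j on Λ_j … V_k = V», trivial history `Λ_k = T_η`; [Balaban1987RG1] (0.21) p.256; [Balaban1985Variational] Thm 1 p.279 for the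
  regular space), via `Setup.IsBackground` with the regular class `{PlaqSmall δreg}`: `avg^k(bg V) = V`, `bg V` regular, and minimal
  among regular fine configurations averaging to `V`. -/
  isBackground : ∀ V, PlaqSmall prm.δ V → IsBackground av {U | PlaqSmall prm.δreg U} k V (bg V)
  /-- Every domain has a footprint (domains are non-empty unions of blocks, p.262). -/
  foot_nonempty : ∀ X, (foot X).Nonempty
  /-- The fine support lies under the footprint: the `k`-fold block point of the initial site of every supporting bond is a footprint site
  (p.266 (43): «y represents big blocks … contained in Ω_k … and c_i are bonds in Ω_k^{(j)}»). -/
  supp_foot : ∀ X b, b ∈ supp X → iterBlockOf k b.src ∈ foot X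
  /-- Linear sizes are non-negative ((24) p.262). -/
  len_nonneg : ∀ X, 0 ≤ len X
  /-- Size weights are non-negative ((44) p.267). -/
  wt_nonneg : ∀ X, 0 ≤ wt X
  /-- FOOTPRINT DIAMETER ≤ `M·(𝓛 + 1)` in level-`k` lattice steps — READING of p.263 «The localization domain X is contained in a cube □ of
  the size RM₁» with the definition of `𝓛(X)` p.262 (blocks scaled to unit cubes) for a domain of level `i ≤ k` read at level `k`. -/
  diam_foot : ∀ X, ∀ y ∈ foot X, ∀ y' ∈ foot X, (Site.tdist y y' : ℝ) ≤ prm.M * (len X + 1)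
  /-- LOCALITY (p.263 «The second is a localization property with respect to U₁. The expression 𝒫′₁(g₀, X, U₁) depends on U₁ restricted to
  the set X̃»; [Balaban1987RG1] (0.24) p.257 «depending on U restricted to X»). -/
  act_local : ∀ X (U U' : GaugeField P 0 G), (∀ b ∈ supp X, U b = U' b) → act X U = act X U'
  /-- GAUGE INVARIANCE (26) p.263 «𝒫′₁(g₀, X, U₁^u) = 𝒫′₁(g₀, X, U₁) for all gauge transformations u»; [Balaban1987RG1] (0.24) p.257. -/
  act_gaugeInvariant : ∀ X, GaugeField.GaugeInvariant (act X)
  /-- THE SIZE OF ONE ACTIVITY AT THE BACKGROUND OF A SMALL DATUM ((25) p.262 «|𝒫′₁(g₀, X, U₁)| ≤ O(g₀)e^{−κ𝓛(X)}, where κ can be arbitrarily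
  large if M₁ is sufficiently large»; (43)–(44) p.266–267 under the regularity of `U_k`; [Balaban1987RG1] (0.25) p.257
  «|E^{(j)}(X, U)| ≤ E₀ exp(−κd_j(X))»), the level-dependent prefactor carried by `wt X`. -/
  act_bound : ∀ X V, PlaqSmall prm.δ V → |act X (bg V)| ≤ wt X * Real.exp (-(prm.κ * len X))
  /-- LOCAL SUMMABILITY OF THE WEIGHTED DOMAIN SYSTEM ((45) p.267 «By the assumption n ≥ 2, summation over all Y_j with y fixed yields for
  g_{k−1} sufficiently small Σ_{Y_j: y = y₀} |𝒫_j(Y_j, U_k)| ≤ O(1)(O(M₁³)g_{k−1}p(g_{k−1}))²(Lʲη)⁴», summed over the levels as in (46);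
  [Balaban1987RG1] (0.26)/(0.30) pp.257–258), READ per level-`k` footprint site: `Σ_{X ∋ y} wt X·e^{−κ𝓛(X)} ≤ Ccov`. -/
  cover : ∀ y : Site P k,
    ∑ X ∈ Finset.univ.filter (fun X => y ∈ foot X), wt X * Real.exp (-(prm.κ * len X)) ≤ prm.Ccov
  /-- THE SIZE OF THE CONSTANT ((65) p.273 «|E_k| ≤ O(1)|T₁^{(k)}|», `|T₁^{(k)}|` = the number of sites of `T^{(k)}`). -/
  cst_abs_le : |cst| ≤ prm.cE * Fintype.card (Site P k)
  /-- (47) p.267 — THE LOWER BOUND ON THE ALL-SMALL DATUM SET: «ρ_k(V) ≥ χ_k exp[−(1/g_k²)A^η(U_k) + Σ_{j=1}^k Σ_{Y_j} 𝒫_j(Y_j, U_k) − E_k −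
  Σ_{j=0}^{k−1} O((Lʲε)^{3+κ₀})|T₁^{(j)}|], where the characteristic function χ_k corresponds to the restrictions on V given by the conditions
  |U_k(∂p) − 1| < g_kp(g_k)η², p ⊂ T_η». -/
  lower : ∀ V, PlaqSmall prm.δ V →
    Real.exp (-(prm.β * wilsonAction4 (bg V)) + (∑ X, act X (bg V)) + cst - prm.slack) ≤ r V
  /-- (41) p.266 — THE UPPER BOUND ON THE ALL-SMALL DATUM SET: the trivial-history term «χ_k … exp[−(1/g_k²)A^η(U_k) + Σ_{j=1}^{k} Σ_{Y_j}
  𝒫_j(Y_j, U_k) − E_k + … + Σ_{j=0}^{k−1} O((Lʲε)^{3+κ₀})|T₁^{(j)}|]» (`χ_k ≤ 1`) plus the remaining large-field histories `lf(V)`. -/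
  upper : ∀ V, PlaqSmall prm.δ V →
    r V ≤ Real.exp (-(prm.β * wilsonAction4 (bg V)) + (∑ X, act X (bg V)) + cst + prm.slack) + lf V
  /-- The large-field part is non-negative (every history of (41) p.266 is a non-negative term; [Balaban1989LargeFieldI] p.176). -/
  lf_nonneg : ∀ V, 0 ≤ lf V
  /-- THE LARGE-FIELD HISTORIES ARE SUPPRESSED (Sect. D p.273–274: «the corresponding part of the exponential gives the small factor
  exp(−¼p²(g_j)). We get these small factors for all plaquettes in all large fields set P … The analysis of Sect. 3.C [9], which is model
  independent, show that these small factors are enough to control all sums in (41), together with the second term in (65)»; every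
  non-trivial history has at least one large plaquette at some level `i < k`, and `p(g_i) ≥ p(g_k)` in d = 3): `lf ≤ e^{−cLF}·e^{c5|T^{(k)}|}`. -/
  lf_le : ∀ V, lf V ≤ Real.exp (-prm.cLF) * Real.exp (prm.c5 * Fintype.card (Site P k))
  /-- PER-PLAQUETTE SMALL FACTORS FOR LARGE TOP-LEVEL PLAQUETTES ((67)–(71) p.273 «Let us take a plaquette p′ ⊂ Λ_j and such that
  |V_j(∂p′) − 1| ≥ g_jp(g_j) … (1/g_k²)Σ_{p⊂Δ′} η^{−1}[1 − Re tr U_k(∂p)] ≥ ¼p²(g_j)», read at `j = k`, `V_k = V`, with [9] Sect. 3.C and (5)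
  p.256 «ρ_k(U) ≤ exp O(1)|T₁^{(k)}|»; [Balaban1988Convergent] p.244 «exp[−(1/g₀²)[1 − Re tr U(∂p)]] ≤ exp(−½p₀²(g₀)) … This is enough to
  control expressions arising in the large field regions surrounding the plaquette p for all steps»): for a finite set `S` of level-`k`
  plaquettes that are all `δL`-large in `V`, `r(V) ≤ e^{−cLF·|S|}·e^{c5|T^{(k)}|}` (`S = ∅` is the upper bound (5)). -/
  large : ∀ V (S : Finset (Plaq P k)), (∀ p ∈ S, prm.δL ≤ dist1 (GaugeField.plaqHol V p)) →
    r V ≤ Real.exp (-(prm.cLF * S.card)) * Real.exp (prm.c5 * Fintype.card (Site P k))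

/-- **MEMBERSHIP IN BAŁABAN'S CLASS** at level `k` of the run `P` with averaging `av` and parameters `prm`: a witness exists.  A PREDICATE
on the density; nothing is asserted about any particular density. [cite: Balaban1985UV3, (41)-(47) pp.266-267; Balaban1987RG1, (0.22)-(0.25) pp.256-257] -/
def Mem (av : (i : ℕ) → Averaging P i G) (prm : ClassParams) (r : GaugeField P k G → ℝ) : Prop :=
  Nonempty (Witness av prm r)

namespace Witness

variable {av : (i : ℕ) → Averaging P i G} {prm : ClassParams} {r : GaugeField P k G → ℝ} (W : Witness av prm r)

/-- The small-field EFFECTIVE ACTION of the witness at the datum `V`: `−β·A(U_k(V)) + Σ_X E(X, U_k(V)) − E_k` ((41)/(47) pp.266–267;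
[Balaban1987RG1] (0.22) p.256 «A_k(g_k, V) = −(1/g_k²)A(U_k(V)) + E_k(U_k(V))»). [cite: Balaban1987RG1, (0.22) p.256] -/
def eff (V : GaugeField P k G) : ℝ :=
  -(prm.β * wilsonAction4 (W.bg V)) + (∑ X, W.act X (W.bg V)) + W.cst

/-- (47) in terms of `eff`: `exp(eff V − slack) ≤ r V` on the all-small set. [cite: Balaban1985UV3, (47) p.267] -/
theorem exp_eff_sub_le (V : GaugeField P k G) (hV : PlaqSmall prm.δ V) : Real.exp (W.eff V - prm.slack) ≤ r V :=
  W.lower V hV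

/-- (41) in terms of `eff`: `r V ≤ exp(eff V + slack) + lf V` on the all-small set. [cite: Balaban1985UV3, (41) p.266] -/
theorem le_exp_eff_add (V : GaugeField P k G) (hV : PlaqSmall prm.δ V) : r V ≤ Real.exp (W.eff V + prm.slack) + W.lf V :=
  W.upper V hV

/-- The background averages back to the datum: `avg^k(U_k(V)) = V` ((42) p.266 at the trivial history; (67) p.273). [cite: Balaban1985UV3, (42) p.266] -/
theorem iter_bg (V : GaugeField P k G) (hV : PlaqSmall prm.δ V) : Averaging.iter av k (W.bg V) = V :=
  (W.isBackground V hV).1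

/-- The background of a small datum is regular: `U_k(V) ∈ {PlaqSmall δreg}` ((44) p.267 «The configuration U_k satisfies the following
regularity condition»; (68) p.273). [cite: Balaban1985UV3, (44) p.267, (68) p.273] -/
theorem bg_regular (V : GaugeField P k G) (hV : PlaqSmall prm.δ V) : PlaqSmall prm.δreg (W.bg V) :=
  (W.isBackground V hV).2.1

/-- The background minimises the Wilson action among regular fine configurations with the same `k`-fold average ((42) p.266;
[Balaban1987RG1] (0.21) p.256). [cite: Balaban1985UV3, (42) p.266] -/
theorem wilsonAction4_bg_le (V : GaugeField P k G) (hV : PlaqSmall prm.δ V) (U : GaugeField P 0 G)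
    (hU : PlaqSmall prm.δreg U) (havg : Averaging.iter av k U = V) : wilsonAction4 (W.bg V) ≤ wilsonAction4 U :=
  (W.isBackground V hV).2.2 U hU havg

/-- An activity vanishes in differences of fine configurations that agree on its support (locality p.263, restated as a congruence).
[cite: Balaban1985UV3, p.263] -/
theorem act_congr (X : Fin W.nDom) {U U' : GaugeField P 0 G} (h : ∀ b ∈ W.supp X, U b = U' b) : W.act X U = W.act X U' :=
  W.act_local X U U' h

/-- Activities are functions of gauge orbits ((26) p.263). [cite: Balaban1985UV3, (26) p.263] -/
theorem act_gaugeAct (X : Fin W.nDom) (u : GaugeTransf P 0 G) (U : GaugeField P 0 G) :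
    W.act X (GaugeField.gaugeAct u U) = W.act X U :=
  W.act_gaugeInvariant X u U

/-- The weighted decay factor of a domain is non-negative. [cite: Balaban1985UV3, (44) p.267] -/
theorem wt_mul_exp_nonneg (X : Fin W.nDom) : 0 ≤ W.wt X * Real.exp (-(prm.κ * W.len X)) :=
  mul_nonneg (W.wt_nonneg X) (Real.exp_nonneg _)

/-- Double counting behind (46): a sum over domains is at most the sum over level-`k` sites of the sums over the domains whose footprint
contains the site (every footprint is non-empty). [cite: Balaban1985UV3, (45)-(46) p.267] -/
theorem sum_le_sum_foot (f : Fin W.nDom → ℝ) (hf : ∀ X, 0 ≤ f X) :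
    ∑ X, f X ≤ ∑ y : Site P k, ∑ X ∈ Finset.univ.filter (fun X => y ∈ W.foot X), f X := by
  classical
  have h1 : ∀ X, f X ≤ ∑ _y ∈ W.foot X, f X := fun X => by
    rw [Finset.sum_const, nsmul_eq_mul]
    have hc : (1 : ℝ) ≤ (W.foot X).card := by exact_mod_cast (W.foot_nonempty X).card_pos
    nlinarith [hf X]
  have h2 : ∀ X, ∑ _y ∈ W.foot X, f X = ∑ y : Site P k, if y ∈ W.foot X then f X else 0 := fun X => by
    rw [← Finset.sum_filter]
    congr 1
    ext y
    simp
  calc ∑ X, f X ≤ ∑ X, ∑ _y ∈ W.foot X, f X := Finset.sum_le_sum fun X _ => h1 X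
    _ = ∑ X, ∑ y : Site P k, (if y ∈ W.foot X then f X else 0) := Finset.sum_congr rfl fun X _ => h2 X
    _ = ∑ y : Site P k, ∑ X, (if y ∈ W.foot X then f X else 0) := Finset.sum_comm
    _ = ∑ y : Site P k, ∑ X ∈ Finset.univ.filter (fun X => y ∈ W.foot X), f X :=
        Finset.sum_congr rfl fun y _ => (Finset.sum_filter _ _).symm

/-- **(46) p.267 FROM THE CLAUSES** — «Σ_{j=1}^k Σ_{Y_j} |𝒫_j(Y_j, U_k)| ≤ O(1)M₁³g²_{k−1}p²(g_{k−1})|Λ_k|. Thus the sum is not only convergent, but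
also small» ([Balaban1987RG1] (0.30) p.258 «the only dependence on k is through the volume |T_η^{(k)}|»): at the background of an all-small
datum the activities sum absolutely to at most `Ccov·|T^{(k)}|`.  Re-derived bookkeeping: `act_bound`, then `sum_le_sum_foot`, then `cover`.
[cite: Balaban1985UV3, (46) p.267] -/
theorem sum_abs_act_le (V : GaugeField P k G) (hV : PlaqSmall prm.δ V) :
    ∑ X, |W.act X (W.bg V)| ≤ prm.Ccov * Fintype.card (Site P k) := by
  classical
  calc ∑ X, |W.act X (W.bg V)| ≤ ∑ X, W.wt X * Real.exp (-(prm.κ * W.len X)) :=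
        Finset.sum_le_sum fun X _ => W.act_bound X V hV
    _ ≤ ∑ y : Site P k, ∑ X ∈ Finset.univ.filter (fun X => y ∈ W.foot X), W.wt X * Real.exp (-(prm.κ * W.len X)) :=
        W.sum_le_sum_foot _ W.wt_mul_exp_nonneg
    _ ≤ ∑ _y : Site P k, prm.Ccov := Finset.sum_le_sum fun y _ => W.cover y
    _ = prm.Ccov * Fintype.card (Site P k) := by
        rw [Finset.sum_const, nsmul_eq_mul, Finset.card_univ, mul_comm]

/-- The activity sum at the background of an all-small datum, without absolute values: `|Σ_X E(X, U_k(V))| ≤ Ccov·|T^{(k)}|`.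
[cite: Balaban1985UV3, (46) p.267] -/
theorem abs_sum_act_le (V : GaugeField P k G) (hV : PlaqSmall prm.δ V) :
    |∑ X, W.act X (W.bg V)| ≤ prm.Ccov * Fintype.card (Site P k) :=
  (Finset.abs_sum_le_sum_abs _ _).trans (W.sum_abs_act_le V hV)

/-- The effective action of an all-small datum is within `(Ccov + cE)·|T^{(k)}|` of its main term `−β·A(U_k(V))` — (46) p.267 with (65)
p.273, i.e. the exponent (66) p.273. [cite: Balaban1985UV3, (65)-(66) p.273] -/
theorem abs_eff_add_main_le (V : GaugeField P k G) (hV : PlaqSmall prm.δ V) :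
    |W.eff V + prm.β * wilsonAction4 (W.bg V)| ≤ (prm.Ccov + prm.cE) * Fintype.card (Site P k) := by
  have h1 := W.abs_sum_act_le V hV
  have h2 := W.cst_abs_le
  have : W.eff V + prm.β * wilsonAction4 (W.bg V) = (∑ X, W.act X (W.bg V)) + W.cst := by
    unfold eff; ring
  rw [this, add_mul]
  exact (abs_add_le _ _).trans (add_le_add h1 h2)

/-- **THEOREM 1, LOWER HALF OF (5) p.256, FROM THE CLAUSES** — «χ(U) exp[−(1/g_k²)A^η(U_k(U)) − O(1)|T₁^{(k)}|] ≤ ρ_k(U)» on the all-small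
datum set, with the honest constant `(Ccov + cE)·|T^{(k)}| + slack` (p.274 «The lower bound is simpler, it is enough to use (44)–(46)
and (66)»).  Re-derived bookkeeping over `lower`, `sum_abs_act_le`, `cst_abs_le`. [cite: Balaban1985UV3, Thm 1 (5) pp.256-257, p.274] -/
theorem bounds5_lower (V : GaugeField P k G) (hV : PlaqSmall prm.δ V) :
    Real.exp (-(prm.β * wilsonAction4 (W.bg V)) - (prm.Ccov + prm.cE) * Fintype.card (Site P k) - prm.slack) ≤ r V := by
  refine le_trans (Real.exp_le_exp.mpr ?_) (W.exp_eff_sub_le V hV)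
  have h := (abs_le.mp (W.abs_eff_add_main_le V hV)).1
  linarith

/-- **THEOREM 1, UPPER HALF OF (5) p.256, FROM THE CLAUSES** — «ρ_k(U) ≤ exp O(1)|T₁^{(k)}|» for every datum: the case `S = ∅` of the
large-field clause. [cite: Balaban1985UV3, Thm 1 (5) pp.256-257] -/
theorem bounds5_upper (W : Witness av prm r) (V : GaugeField P k G) :
    r V ≤ Real.exp (prm.c5 * Fintype.card (Site P k)) := by
  simpa using W.large V ∅ (by simp)

/-- On the all-small datum set the density is at most the exponentiated effective action (with the slack) plus the suppressed
large-field part — (41) p.266 with Sect. D's small factors p.273. [cite: Balaban1985UV3, (41) p.266, Sect. D p.273] -/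
theorem le_exp_eff_add_exp (V : GaugeField P k G) (hV : PlaqSmall prm.δ V) :
    r V ≤ Real.exp (W.eff V + prm.slack) + Real.exp (-prm.cLF) * Real.exp (prm.c5 * Fintype.card (Site P k)) :=
  (W.le_exp_eff_add V hV).trans (add_le_add le_rfl (W.lf_le V))

/-- A datum with one `δL`-large level-`k` plaquette carries one small factor: `r V ≤ e^{−cLF}·e^{c5|T^{(k)}|}` ((71) p.273).
[cite: Balaban1985UV3, (71) p.273] -/
theorem le_of_large_plaq (W : Witness av prm r) (V : GaugeField P k G) (p : Plaq P k)
    (hp : prm.δL ≤ dist1 (GaugeField.plaqHol V p)) :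
    r V ≤ Real.exp (-prm.cLF) * Real.exp (prm.c5 * Fintype.card (Site P k)) := by
  simpa using W.large V {p} (by simpa using hp)

/-- The density is integrable against any finite measure on the (finite-dimensional, compact-group valued) configuration space once it is
bounded — here from `bounds5_upper` and `nonneg`; stated for the product Haar measure `dV` ([Balaban1985Averaging] (10) p.19), which is a
probability measure. [cite: Balaban1985Averaging, (10) p.19] -/
theorem integrable [HaarData G] (W : Witness av prm r) : Integrable r (fieldMeasure P k G) := by
  haveI : IsProbabilityMeasure (fieldMeasure P k G) := Missing.isProbabilityMeasure_fieldMeasure (G := G) P k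
  refine Integrable.of_bound (W.measurable.aestronglyMeasurable) (Real.exp (prm.c5 * Fintype.card (Site P k))) ?_
  exact Filter.Eventually.of_forall fun V => by
    rw [Real.norm_eq_abs, abs_of_nonneg (W.nonneg V)]
    exact W.bounds5_upper V

end Witness

/-- **WEAKER PARAMETERS** (`prm ≼ prm'`): the window on which the clauses are demanded shrinks (`δ' ≤ δ`), the large threshold, the
diameter constant, the per-site budgets, the slack and the stability constant grow, the large-field exponent shrinks; `β`, `κ` and the
regular window are unchanged (every printed «O(1) … for g sufficiently small / M₁ sufficiently large» is monotone in this sense — the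
bookkeeping by which constants of finitely many steps or runs are made common, e.g. (5) p.256 «the constant O(1) is independent of
ε, k, g_k in a bounded set»). [cite: Balaban1985UV3, (5) pp.256-257] -/
structure ClassParams.Weaker (prm prm' : ClassParams) : Prop where
  /-- the all-small window shrinks -/
  δ_le : prm'.δ ≤ prm.δ
  /-- the regular window is unchanged -/
  δreg_eq : prm'.δreg = prm.δreg
  /-- the large-plaquette threshold grows -/
  δL_le : prm.δL ≤ prm'.δL
  /-- the main coefficient is unchanged -/
  β_eq : prm'.β = prm.β
  /-- the decay rate is unchanged -/
  κ_eq : prm'.κ = prm.κ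
  /-- the diameter constant grows -/
  M_le : prm.M ≤ prm'.M
  /-- the per-site activity budget grows -/
  Ccov_le : prm.Ccov ≤ prm'.Ccov
  /-- the per-site vacuum-energy constant grows -/
  cE_le : prm.cE ≤ prm'.cE
  /-- the slack grows -/
  slack_le : prm.slack ≤ prm'.slack
  /-- the large-field exponent shrinks -/
  cLF_le : prm'.cLF ≤ prm.cLF
  /-- the stability constant grows -/
  c5_le : prm.c5 ≤ prm'.c5

/-- `Weaker` is reflexive. [cite: Balaban1985UV3, (5) pp.256-257] -/
theorem ClassParams.Weaker.refl (prm : ClassParams) : prm.Weaker prm :=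
  ⟨le_rfl, rfl, le_rfl, rfl, rfl, le_rfl, le_rfl, le_rfl, le_rfl, le_rfl, le_rfl⟩

/-- `Weaker` is transitive. [cite: Balaban1985UV3, (5) pp.256-257] -/
theorem ClassParams.Weaker.trans {prm prm' prm'' : ClassParams} (h : prm.Weaker prm') (h' : prm'.Weaker prm'') :
    prm.Weaker prm'' :=
  ⟨h'.δ_le.trans h.δ_le, h'.δreg_eq.trans h.δreg_eq, h.δL_le.trans h'.δL_le, h'.β_eq.trans h.β_eq, h'.κ_eq.trans h.κ_eq,
    h.M_le.trans h'.M_le, h.Ccov_le.trans h'.Ccov_le, h.cE_le.trans h'.cE_le, h.slack_le.trans h'.slack_le,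
    h'.cLF_le.trans h.cLF_le, h.c5_le.trans h'.c5_le⟩

namespace Witness

variable {av : (i : ℕ) → Averaging P i G} {prm prm' : ClassParams} {r : GaugeField P k G → ℝ}

/-- **A WITNESS FOR `prm` IS A WITNESS FOR EVERY WEAKER `prm'`** (same data). [cite: Balaban1985UV3, (5) pp.256-257] -/
def relax (W : Witness av prm r) (h : prm.Weaker prm') : Witness av prm' r where
  bg := W.bg
  nDom := W.nDom
  supp := W.supp
  foot := W.foot
  len := W.len
  wt := W.wt
  act := W.act
  cst := W.cst
  lf := W.lf
  nonneg := W.nonneg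
  measurable := W.measurable
  gaugeInvariant := W.gaugeInvariant
  isBackground := fun V hV => by
    rw [h.δreg_eq]
    exact W.isBackground V fun p => (hV p).trans_le h.δ_le
  foot_nonempty := W.foot_nonempty
  supp_foot := W.supp_foot
  len_nonneg := W.len_nonneg
  wt_nonneg := W.wt_nonneg
  diam_foot := fun X y hy y' hy' =>
    (W.diam_foot X y hy y' hy').trans
      (mul_le_mul_of_nonneg_right h.M_le (by linarith [W.len_nonneg X]))
  act_local := W.act_local
  act_gaugeInvariant := W.act_gaugeInvariant
  act_bound := fun X V hV => by
    rw [h.κ_eq]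
    exact W.act_bound X V fun p => (hV p).trans_le h.δ_le
  cover := fun y => by
    rw [h.κ_eq]
    exact (W.cover y).trans h.Ccov_le
  cst_abs_le := W.cst_abs_le.trans (mul_le_mul_of_nonneg_right h.cE_le (Nat.cast_nonneg _))
  lower := fun V hV => by
    rw [h.β_eq]
    refine le_trans (Real.exp_le_exp.mpr ?_) (W.lower V fun p => (hV p).trans_le h.δ_le)
    linarith [h.slack_le]
  upper := fun V hV => by
    rw [h.β_eq]
    refine (W.upper V fun p => (hV p).trans_le h.δ_le).trans (add_le_add (Real.exp_le_exp.mpr ?_) le_rfl)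
    linarith [h.slack_le]
  lf_nonneg := W.lf_nonneg
  lf_le := fun V => (W.lf_le V).trans (mul_le_mul (Real.exp_le_exp.mpr (by linarith [h.cLF_le]))
    (Real.exp_le_exp.mpr (mul_le_mul_of_nonneg_right h.c5_le (Nat.cast_nonneg _))) (Real.exp_nonneg _) (Real.exp_nonneg _))
  large := fun V S hS =>
    (W.large V S fun p hp => h.δL_le.trans (hS p hp)).trans
      (mul_le_mul (Real.exp_le_exp.mpr (by nlinarith [h.cLF_le, (Nat.cast_nonneg S.card : (0 : ℝ) ≤ S.card)]))
        (Real.exp_le_exp.mpr (mul_le_mul_of_nonneg_right h.c5_le (Nat.cast_nonneg _))) (Real.exp_nonneg _)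
        (Real.exp_nonneg _))

end Witness

namespace Mem

variable {av : (i : ℕ) → Averaging P i G} {prm : ClassParams} {r : GaugeField P k G → ℝ}

/-- A witness gives membership. [cite: Balaban1985UV3, (41)-(47) pp.266-267] -/
theorem of_witness (W : Witness av prm r) : Mem av prm r := ⟨W⟩

/-- Membership is monotone under weakening the parameters. [cite: Balaban1985UV3, (5) pp.256-257] -/
theorem relax {prm' : ClassParams} (h : Mem av prm r) (hw : prm.Weaker prm') : Mem av prm' r := by
  obtain ⟨W⟩ := h; exact ⟨W.relax hw⟩

/-- Members are non-negative densities. [cite: Balaban1989LargeFieldI, p.176] -/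
theorem nonneg (h : Mem av prm r) (V : GaugeField P k G) : 0 ≤ r V := by
  obtain ⟨W⟩ := h; exact W.nonneg V

/-- Members are measurable. [cite: Balaban1985Averaging, (10) p.19] -/
theorem measurable (h : Mem av prm r) : Measurable r := by
  obtain ⟨W⟩ := h; exact W.measurable

/-- Members are gauge invariant. [cite: Balaban1985Averaging, (12)-(13) p.19] -/
theorem gaugeInvariant (h : Mem av prm r) : GaugeField.GaugeInvariant r := by
  obtain ⟨W⟩ := h; exact W.gaugeInvariant

/-- Members obey the upper bound (5) p.256: `r ≤ e^{c5|T^{(k)}|}`. [cite: Balaban1985UV3, Thm 1 (5) pp.256-257] -/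
theorem le_exp (h : Mem av prm r) (V : GaugeField P k G) : r V ≤ Real.exp (prm.c5 * Fintype.card (Site P k)) := by
  obtain ⟨W⟩ := h; exact W.bounds5_upper V

/-- Members obey the lower bound (5) p.256 on the all-small datum set, for SOME regular fine configuration averaging to the datum (the
witness's background). [cite: Balaban1985UV3, Thm 1 (5) pp.256-257] -/
theorem exists_exp_le (h : Mem av prm r) (V : GaugeField P k G) (hV : PlaqSmall prm.δ V) :
    ∃ U : GaugeField P 0 G, Averaging.iter av k U = V ∧ PlaqSmall prm.δreg U ∧
      Real.exp (-(prm.β * wilsonAction4 U) - (prm.Ccov + prm.cE) * Fintype.card (Site P k) - prm.slack) ≤ r V := by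
  obtain ⟨W⟩ := h
  exact ⟨W.bg V, W.iter_bg V hV, W.bg_regular V hV, W.bounds5_lower V hV⟩

/-- A datum with a `δL`-large plaquette is suppressed ((71) p.273). [cite: Balaban1985UV3, (71) p.273] -/
theorem le_of_large_plaq (h : Mem av prm r) (V : GaugeField P k G) (p : Plaq P k)
    (hp : prm.δL ≤ dist1 (GaugeField.plaqHol V p)) :
    r V ≤ Real.exp (-prm.cLF) * Real.exp (prm.c5 * Fintype.card (Site P k)) := by
  obtain ⟨W⟩ := h; exact W.le_of_large_plaq V p hp

/-- Members are integrable for the product Haar measure. [cite: Balaban1985Averaging, (10) p.19] -/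
theorem integrable [HaarData G] (h : Mem av prm r) : Integrable r (fieldMeasure P k G) := by
  obtain ⟨W⟩ := h; exact W.integrable

end Mem

/-! ## §2 The reading at height `j` of the d = 3 Wilson towers of a `T3Family` -/

section Height

variable (F : T3Family) {G : Type*}

/-- Equal moduli `2L^{m+j}`: level `0` of run `j` and level `K − j` of run `K ≥ j` of ONE three-torus family are the same lattice
(`T3LevelShift.sitesPerDir_eq`; [Balaban1985UV3] (1)–(3) p.256: the `K`-th approximation has `K` steps to the unit lattice).
[cite: Balaban1985UV3, (1)-(3) p.256] -/
theorem heightShift_eq {j K : ℕ} (hK : j ≤ K) : (F.PP F.m j).sitesPerDir 0 = (F.PP F.m K).sitesPerDir (K - j) :=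
  F.sitesPerDir_eq (by omega)

/-- **READING A HEIGHT-`j` DENSITY ON RUN `K`**: a function of the planner's height-`j` configurations `GaugeField (F.P j) 0 G` read as a
function of run `K`'s level-`(K − j)` configurations through `fieldShift` (the same device as `T3AlphaInputsAC.AlphaDataT3.PintH`).
[cite: Balaban1985UV3, (1)-(3) p.256] -/
def readAtLevel {j K : ℕ} (hK : j ≤ K) (r : GaugeField (F.P j) 0 G → ℝ) : GaugeField (F.P K) (K - j) G → ℝ :=
  fun W => r (fieldShift (heightShift_eq F hK) W)

/-- Unfolding `readAtLevel`. [cite: Balaban1985UV3, (1)-(3) p.256] -/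
theorem readAtLevel_apply {j K : ℕ} (hK : j ≤ K) (r : GaugeField (F.P j) 0 G → ℝ) (W : GaugeField (F.P K) (K - j) G) :
    readAtLevel F hK r W = r (fieldShift (heightShift_eq F hK) W) := rfl

/-- Reading back: `r V = (readAtLevel r)(V read on run K)`. [cite: Balaban1985UV3, (1)-(3) p.256] -/
theorem readAtLevel_fieldShift_symm {j K : ℕ} (hK : j ≤ K) (r : GaugeField (F.P j) 0 G → ℝ) (V : GaugeField (F.P j) 0 G) :
    readAtLevel F hK r (fieldShift (heightShift_eq F hK).symm V) = r V := by
  rw [readAtLevel_apply, fieldShift_symm_fieldShift]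

variable [MeasurableSpace G]

/-- `readAtLevel` preserves measurability. [cite: Balaban1985Averaging, (10) p.19] -/
theorem measurable_readAtLevel {j K : ℕ} (hK : j ≤ K) {r : GaugeField (F.P j) 0 G → ℝ} (hr : Measurable r) :
    Measurable (readAtLevel F hK r) :=
  hr.comp (measurable_fieldShift _)

/-- Conversely a measurable reading comes from a measurable height density. [cite: Balaban1985Averaging, (10) p.19] -/
theorem measurable_of_readAtLevel {j K : ℕ} (hK : j ≤ K) {r : GaugeField (F.P j) 0 G → ℝ}
    (hr : Measurable (readAtLevel F hK r)) : Measurable r := by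
  have : r = readAtLevel F hK r ∘ fieldShift (heightShift_eq F hK).symm := by
    funext V; exact (readAtLevel_fieldShift_symm F hK r V).symm
  rw [this]
  exact hr.comp (measurable_fieldShift _)

variable [GaugeGroup G]

/-- **MEMBERSHIP OF A HEIGHT-`j` DENSITY READ ON THE RUN `K ≥ j`**: the density `r` on `GaugeField (F.P j) 0 G`, read on level `K − j` of run
`K`, is in Bałaban's class for the block averaging `BlockAveraging.blockAvg ℰ` ([Balaban1987RG1] (0.4) p.253) of run `K` — the background
lives on run `K`'s finest lattice `T_{ε_K}`, as in print ((42) p.266: `U_k` on `T_η`).  The averaging of record of the cell is `ℰ = ℰp`.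
[cite: Balaban1985UV3, (41)-(47) pp.266-267] -/
def MemOfRun (ℰ : LoopAverage G) {j K : ℕ} (hK : j ≤ K) (prm : ClassParams) (r : GaugeField (F.P j) 0 G → ℝ) : Prop :=
  Mem (P := F.P K) (k := K - j) (fun i => BlockAveraging.blockAvg (P := F.P K) (j := i) ℰ) prm (readAtLevel F hK r)

/-- **MEMBERSHIP AT HEIGHT `j`**: for SOME run `K ≥ j` the height-`j` density read on run `K` is in the class (the fine run is part of the
witness).  «Uniformly in the cutoff» is the consumer's `∀ K ≥ j, MemOfRun F ℰ hK prm (r K)` with one `prm` per height.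
[cite: Balaban1985UV3, (41)-(47) pp.266-267] -/
def MemAtHeight (ℰ : LoopAverage G) (j : ℕ) (prm : ClassParams) (r : GaugeField (F.P j) 0 G → ℝ) : Prop :=
  ∃ K : ℕ, ∃ hK : j ≤ K, MemOfRun F ℰ hK prm r

variable {F}

/-- A run-`K` membership is a height membership. [cite: Balaban1985UV3, (41)-(47) pp.266-267] -/
theorem MemOfRun.memAtHeight {ℰ : LoopAverage G} {j K : ℕ} {hK : j ≤ K} {prm : ClassParams} {r : GaugeField (F.P j) 0 G → ℝ}
    (h : MemOfRun F ℰ hK prm r) : MemAtHeight F ℰ j prm r :=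
  ⟨K, hK, h⟩

/-- Height members are non-negative. [cite: Balaban1989LargeFieldI, p.176] -/
theorem MemAtHeight.nonneg {ℰ : LoopAverage G} {j : ℕ} {prm : ClassParams} {r : GaugeField (F.P j) 0 G → ℝ}
    (h : MemAtHeight F ℰ j prm r) (V : GaugeField (F.P j) 0 G) : 0 ≤ r V := by
  obtain ⟨K, hK, hm⟩ := h
  rw [← readAtLevel_fieldShift_symm F hK r V]
  exact Mem.nonneg hm _

/-- Height members are measurable. [cite: Balaban1985Averaging, (10) p.19] -/
theorem MemAtHeight.measurable {ℰ : LoopAverage G} {j : ℕ} {prm : ClassParams} {r : GaugeField (F.P j) 0 G → ℝ}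
    (h : MemAtHeight F ℰ j prm r) : Measurable r := by
  obtain ⟨K, hK, hm⟩ := h
  exact measurable_of_readAtLevel F hK (Mem.measurable hm)

/-- Height members obey the upper bound (5) p.256 with the volume of the height-`j` lattice: `r ≤ e^{c5|T|}`, `|T| = (2L^{m+j})³` sites
(the level-`(K − j)` lattice of run `K` has the same number of sites for every `K`). [cite: Balaban1985UV3, Thm 1 (5) pp.256-257] -/
theorem MemAtHeight.le_exp {ℰ : LoopAverage G} {j : ℕ} {prm : ClassParams} {r : GaugeField (F.P j) 0 G → ℝ}
    (h : MemAtHeight F ℰ j prm r) (V : GaugeField (F.P j) 0 G) :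
    ∃ K : ℕ, j ≤ K ∧ r V ≤ Real.exp (prm.c5 * Fintype.card (Site (F.P K) (K - j))) := by
  obtain ⟨K, hK, hm⟩ := h
  refine ⟨K, hK, ?_⟩
  rw [← readAtLevel_fieldShift_symm F hK r V]
  exact Mem.le_exp hm _

/-- Run-`K` membership is monotone under weakening the parameters. [cite: Balaban1985UV3, (5) pp.256-257] -/
theorem MemOfRun.relax {ℰ : LoopAverage G} {j K : ℕ} {hK : j ≤ K} {prm prm' : ClassParams} {r : GaugeField (F.P j) 0 G → ℝ}
    (h : MemOfRun F ℰ hK prm r) (hw : prm.Weaker prm') : MemOfRun F ℰ hK prm' r :=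
  Mem.relax h hw

/-- Height membership is monotone under weakening the parameters. [cite: Balaban1985UV3, (5) pp.256-257] -/
theorem MemAtHeight.relax {ℰ : LoopAverage G} {j : ℕ} {prm prm' : ClassParams} {r : GaugeField (F.P j) 0 G → ℝ}
    (h : MemAtHeight F ℰ j prm r) (hw : prm.Weaker prm') : MemAtHeight F ℰ j prm' r := by
  obtain ⟨K, hK, hm⟩ := h
  exact ⟨K, hK, hm.relax hw⟩

/-- A height member's integral against the product Haar measure of run `K`'s level `K − j` is the integral of its reading (change of
variables along the level identification, `T3LevelShift.integral_comp_fieldShift`-free form: the reading IS the integrand).  Stated as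
integrability of the reading. [cite: Balaban1985Averaging, (10) p.19] -/
theorem MemOfRun.integrable_readAtLevel [HaarData G] {ℰ : LoopAverage G} {j K : ℕ} {hK : j ≤ K} {prm : ClassParams}
    {r : GaugeField (F.P j) 0 G → ℝ} (h : MemOfRun F ℰ hK prm r) :
    Integrable (readAtLevel F hK r) (fieldMeasure (F.P K) (K - j) G) :=
  Mem.integrable h

end Height

end Literature.MathematicalPhysics.QuantumFieldTheory.Balaban1983to89.BalabanUVClass

end
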